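import Summits.AnomalousDissipation.AnomalousDissipation.Theorems.SolenoidalFractalHomogenisationLagrangianStepCellChainSlot
import Summits.AnomalousDissipation.AnomalousDissipation.Theorems.SolenoidalFractalHomogenisationLagrangianStepCellChainModesFrame
import Summits.AnomalousDissipation.AnomalousDissipation.Theorems.SolenoidalFractalHomogenisationLagrangianStepW7ThreeModeDefsR
import HarnessLib

/-!
# K1L_D (stmt-AnomalousDissipation-27980), (ℓ3) (D-TH)₀ — W7 engine sub-piece S1a AT A FROZEN FRAME `G₀`: inside one slot the twisted chain of a
# weak solution of the distorted cell problem is the GAUGED THREE-TERM CHAIN `dW0R / dWpR / dWmR` (helper; `--supports stmt-AnomalousDissipation-27980 --as helper`)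

Port plan B8 (`HOME/ad-sawtooth-k1loc-p1/g16/W7thg-portplan-k1locp1g16.md`; prover ad-sawtooth-k1loc-p1 g16): the frozen-frame twin of w1's flat
`…CellChainSlot` under the dictionary `transversalProj k ↦ transversalProjR (twistFreq G₀ k)`, `modeRHS/modeRep ↦ modeRHSθ/modeRepθ` (w1 g9/g10
`…CellChainDefsFrame`, `…CellChainModesFrame`), `modalAdjGen 𝔹ᵀ K w ↦ 4π² • P^θ_K T_{(𝔹^{G₀})ᵀ}(K) w`, named shapes `dW0C/dWpC/dWmC ↦ dW0R/dWpR/dWmR`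
(`…W7ThreeModeDefsR`, real wave vectors `G₀ᵀK`).  Setting: `h : IsWeakTensorPassiveVectorDistortedOn 0 T 𝔹 (W₁.cell n) (fun _ _ => G₀) F u`.
The slot bookkeeping of the flat file (§1 `linkCoeff_eq_zero_of_ne`, `linkCoeff_chain`, `linkCoeff_mul_layerAmp(')`, §2 `sum_e_mul_chain_real`,
`gauge_mul_zpow_succ/pred`) is frame-free and reused BY NAME.
* §1 `modeRHSθ_slot`, `modeRHSθ_slot_polar` — one link inside slot `s`, polar form, twisted Leray projection;
* §2 `smul_zpow_modeRHSθ_chain` — the constant diagonal gauge `μ = σ·e^{−iφ_s}` on the twisted chain;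
* §3 `ae_hasDerivAt_gauged_chain_frame` and the three named shapes `ae_hasDerivAt_gauged_dW0R_frame / _dWpR_frame / _dWmR_frame`
  (`dWpR_eq_neg_add`, `dWmR_eq_neg_add`), dampings `ỹⱼ = 4π² • P^θ_{Kⱼ} T_{(𝔹^{G₀})ᵀ}(Kⱼ) w̃ⱼ`.
Everything proved; no definitions, no named facts, no sorry.  NOT a proof of `stub_W7thg`, of K1L_D or of AD; rung F-D1.A0 infrastructure.
[cite: MeshalkinSinai1961, pp. 1700–1705] [cite: Temam1984, Ch. III §1.1] [problem: turb]
-/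

set_option linter.dupNamespace false

noncomputable section

namespace Summit.AnomalousDissipation.AnomalousDissipation.Theorems.SolenoidalFractalHomogenisation.LagrangianStep.CellChain

open Set MeasureTheory Filter Topology Function Complex UnitAddTorus
open scoped InnerProductSpace ComplexConjugate
open Literature.Analysis Literature.Analysis.FunctionSpaces Literature.Analysis.FunctionSpaces.Torus
open Literature.Analysis.FluidPDE Literature.Analysis.FluidPDE.Torus Literature.Analysis.FluidPDE.LatticeShear
open Summit.AnomalousDissipation.AnomalousDissipation.Theorems.SolenoidalFractalHomogenisation.RealisedQuasiStaticCellLaw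
open Summit.AnomalousDissipation.AnomalousDissipation.Theorems.SolenoidalFractalHomogenisation.PermissibleCarrier
open Summit.AnomalousDissipation.AnomalousDissipation.Theorems.SolenoidalFractalHomogenisation.LagrangianStep.ThreeMode

variable {k₀ : ℕ}

/-! ## §1 Inside slot `s`: one link, polar form (twisted Leray projection) -/

/-- **One link inside slot `s`, frozen frame.** [cite: MeshalkinSinai1961, pp. 1700–1705] -/
theorem modeRHSθ_slot (W₁ : LatticeWord k₀) (n : ℕ) (𝔹 : Torus.Visc4 (Fin 3)) (G₀ : Matrix (Fin 3) (Fin 3) ℝ)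
    (u : ℝ → UnitAddTorus (Fin 3) → EuclideanSpace ℝ (Fin 3)) (k : Fin 3 → ℤ) (s : Fin k₀) {τ : ℝ}
    (hτ : Int.fract (τ / W₁.period) * W₁.period ∈ Icc (W₁.start s) (W₁.start s + (W₁.phase s).τ)) :
    modeRHSθ W₁ n 𝔹 G₀ u k τ =
      -(((4 * Real.pi ^ 2 : ℝ) : ℂ) • Torus.transversalProjR (Torus.twistFreq G₀ k)
          (Torus.symbT (Torus.majorTranspose (Torus.Visc4.conj G₀ 𝔹)) k (mFourierCoeff (EuclideanSpace.complexify ∘ u τ) k))) -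
        linkCoeff W₁ n k s τ • Torus.transversalProjR (Torus.twistFreq G₀ k)
          ((Complex.exp ((W₁.phase s).φ * Complex.I) * (1 / (2 * ((2 * Real.pi * ‖latticeVec (W₁.phase s).m‖ : ℝ) : ℂ) * Complex.I))) •
              mFourierCoeff (EuclideanSpace.complexify ∘ u τ) (k - fun i => (W₁.phase s).m i * n) +
            (starRingEnd ℂ (Complex.exp ((W₁.phase s).φ * Complex.I)) *
                (-(1 / (2 * ((2 * Real.pi * ‖latticeVec (W₁.phase s).m‖ : ℝ) : ℂ) * Complex.I)))) •
              mFourierCoeff (EuclideanSpace.complexify ∘ u τ) (k + fun i => (W₁.phase s).m i * n)) := by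
  rw [modeRHSθ_def, Finset.sum_eq_single s (fun j _ hjs => by rw [linkCoeff_eq_zero_of_ne W₁ n k hjs hτ, zero_smul])
    (fun hs => absurd (Finset.mem_univ s) hs)]

/-- **The twisted chain right-hand side inside slot `s`, polar form**:
`modeRHSθ … k τ = −4π² P^θ_k T_{(𝔹^{G₀})ᵀ}(k) û(k) + ℓ • P^θ_k (e^{−iφ_s} û(k + K_s) − e^{iφ_s} û(k − K_s))`, `ℓ = (ê_s·k)(1/n)trap_s(τ)/(2|m_s|)` real.
[cite: MeshalkinSinai1961, pp. 1700–1705] -/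
theorem modeRHSθ_slot_polar (W₁ : LatticeWord k₀) (n : ℕ) (𝔹 : Torus.Visc4 (Fin 3)) (G₀ : Matrix (Fin 3) (Fin 3) ℝ)
    (u : ℝ → UnitAddTorus (Fin 3) → EuclideanSpace ℝ (Fin 3)) (k : Fin 3 → ℤ) (s : Fin k₀) {τ : ℝ}
    (hτ : Int.fract (τ / W₁.period) * W₁.period ∈ Icc (W₁.start s) (W₁.start s + (W₁.phase s).τ)) :
    modeRHSθ W₁ n 𝔹 G₀ u k τ =
      -(((4 * Real.pi ^ 2 : ℝ) : ℂ) • Torus.transversalProjR (Torus.twistFreq G₀ k)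
          (Torus.symbT (Torus.majorTranspose (Torus.Visc4.conj G₀ 𝔹)) k (mFourierCoeff (EuclideanSpace.complexify ∘ u τ) k))) +
        (((∑ a, (W₁.phase s).e a * (k a : ℝ)) * ((1 / (n : ℝ)) * LatticeWord.trapezoid (W₁.start s) (W₁.phase s).τ W₁.ramp
          (Int.fract (τ / W₁.period) * W₁.period)) / (2 * ‖latticeVec (W₁.phase s).m‖) : ℝ) : ℂ) • Torus.transversalProjR (Torus.twistFreq G₀ k)
          (starRingEnd ℂ (Complex.exp ((W₁.phase s).φ * Complex.I)) • mFourierCoeff (EuclideanSpace.complexify ∘ u τ) (k + fun i => (W₁.phase s).m i * n) -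
            Complex.exp ((W₁.phase s).φ * Complex.I) • mFourierCoeff (EuclideanSpace.complexify ∘ u τ) (k - fun i => (W₁.phase s).m i * n)) := by
  rw [modeRHSθ_slot W₁ n 𝔹 G₀ u k s hτ]
  simp only [map_add, map_sub, map_smul, smul_add, smul_sub, smul_smul, linkCoeff_mul_layerAmp, linkCoeff_mul_layerAmp']
  module

/-! ## §2 The constant diagonal gauge `μ = σ · e^{−iφ_s}` on the twisted chain -/

/-- **THE GAUGED TWISTED CHAIN inside slot `s`** (pointwise identity on the a.e.-defined coefficients): with `Kⱼ = K₀ + j·K_s`, `μ = σ·e^{−iφ_s}`,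
`σ = ±1`, `w̃ⱼ = μ^j • û(Kⱼ)` and the real link `ℓ = (ê_s·K₀)(1/n)trap_s(τ)/(2|m_s|)`:
`μ^j • modeRHSθ … Kⱼ τ = −4π² P^θ_{Kⱼ} T_{(𝔹^{G₀})ᵀ}(Kⱼ) w̃ⱼ + (σℓ) • P^θ_{Kⱼ} (w̃ⱼ₊₁ − w̃ⱼ₋₁)`. [cite: MeshalkinSinai1961, pp. 1700–1705] -/
theorem smul_zpow_modeRHSθ_chain (W₁ : LatticeWord k₀) (n : ℕ) (𝔹 : Torus.Visc4 (Fin 3)) (G₀ : Matrix (Fin 3) (Fin 3) ℝ)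
    (u : ℝ → UnitAddTorus (Fin 3) → EuclideanSpace ℝ (Fin 3)) (s : Fin k₀) (K0 : Fin 3 → ℤ) {σ : ℝ} (hσ : σ = 1 ∨ σ = -1)
    (j : ℤ) {τ : ℝ} (hτ : Int.fract (τ / W₁.period) * W₁.period ∈ Icc (W₁.start s) (W₁.start s + (W₁.phase s).τ)) :
    ((σ : ℂ) * starRingEnd ℂ (Complex.exp ((W₁.phase s).φ * Complex.I))) ^ j • modeRHSθ W₁ n 𝔹 G₀ u (K0 + j • (fun i => (W₁.phase s).m i * (n : ℤ))) τ =
      -(((4 * Real.pi ^ 2 : ℝ) : ℂ) • Torus.transversalProjR (Torus.twistFreq G₀ (K0 + j • (fun i => (W₁.phase s).m i * (n : ℤ))))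
          (Torus.symbT (Torus.majorTranspose (Torus.Visc4.conj G₀ 𝔹)) (K0 + j • (fun i => (W₁.phase s).m i * (n : ℤ)))
            (((σ : ℂ) * starRingEnd ℂ (Complex.exp ((W₁.phase s).φ * Complex.I))) ^ j • mFourierCoeff (EuclideanSpace.complexify ∘ u τ) (K0 + j • (fun i => (W₁.phase s).m i * (n : ℤ)))))) +
        ((σ * ((∑ a, (W₁.phase s).e a * (K0 a : ℝ)) * ((1 / (n : ℝ)) * LatticeWord.trapezoid (W₁.start s) (W₁.phase s).τ W₁.ramp
          (Int.fract (τ / W₁.period) * W₁.period)) / (2 * ‖latticeVec (W₁.phase s).m‖) : ℝ) : ℝ) : ℂ) •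
          Torus.transversalProjR (Torus.twistFreq G₀ (K0 + j • (fun i => (W₁.phase s).m i * (n : ℤ))))
          (((σ : ℂ) * starRingEnd ℂ (Complex.exp ((W₁.phase s).φ * Complex.I))) ^ (j + 1) • mFourierCoeff (EuclideanSpace.complexify ∘ u τ) (K0 + (j + 1) • (fun i => (W₁.phase s).m i * (n : ℤ))) -
            ((σ : ℂ) * starRingEnd ℂ (Complex.exp ((W₁.phase s).φ * Complex.I))) ^ (j - 1) • mFourierCoeff (EuclideanSpace.complexify ∘ u τ) (K0 + (j - 1) • (fun i => (W₁.phase s).m i * (n : ℤ)))) := by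
  set μ : ℂ := (σ : ℂ) * starRingEnd ℂ (Complex.exp ((W₁.phase s).φ * Complex.I)) with hμ_def
  have hKp : K0 + (j + 1) • (fun i => (W₁.phase s).m i * (n : ℤ)) = (K0 + j • (fun i => (W₁.phase s).m i * (n : ℤ))) + fun i => (W₁.phase s).m i * (n : ℤ) := by
    rw [add_zsmul, one_zsmul]; abel
  have hKm : K0 + (j - 1) • (fun i => (W₁.phase s).m i * (n : ℤ)) = (K0 + j • (fun i => (W₁.phase s).m i * (n : ℤ))) - fun i => (W₁.phase s).m i * (n : ℤ) := by
    rw [sub_zsmul, one_zsmul]; abel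
  rw [modeRHSθ_slot_polar W₁ n 𝔹 G₀ u _ s hτ, hKp, hKm, sum_e_mul_chain_real]
  set x := mFourierCoeff (EuclideanSpace.complexify ∘ u τ) ((K0 + j • (fun i => (W₁.phase s).m i * (n : ℤ))) - fun i => (W₁.phase s).m i * (n : ℤ))
  set y := mFourierCoeff (EuclideanSpace.complexify ∘ u τ) ((K0 + j • (fun i => (W₁.phase s).m i * (n : ℤ))) + fun i => (W₁.phase s).m i * (n : ℤ))
  set w := mFourierCoeff (EuclideanSpace.complexify ∘ u τ) (K0 + j • (fun i => (W₁.phase s).m i * (n : ℤ)))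
  set ℓ : ℝ := ((∑ a, (W₁.phase s).e a * (K0 a : ℝ)) * ((1 / (n : ℝ)) * LatticeWord.trapezoid (W₁.start s) (W₁.phase s).τ W₁.ramp
          (Int.fract (τ / W₁.period) * W₁.period)) / (2 * ‖latticeVec (W₁.phase s).m‖) : ℝ) with hℓ_def
  rw [smul_add, smul_neg, smul_comm (μ ^ j) (((4 * Real.pi ^ 2 : ℝ) : ℂ)), ← ContinuousLinearMap.map_smul, ← Torus.symbT_smul]
  congr 1
  -- the link part: move all scalars inside the projection and compare coefficients
  have hA := gauge_mul_zpow_succ hσ (W₁.phase s).φ (ℓ : ℂ) j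
  have hB := gauge_mul_zpow_pred hσ (W₁.phase s).φ (ℓ : ℂ) j
  rw [← hμ_def] at hA hB
  push_cast
  simp only [map_sub, map_smul, smul_sub, smul_smul]
  rw [show μ ^ j * ((ℓ : ℂ) * starRingEnd ℂ (Complex.exp ((W₁.phase s).φ * Complex.I))) = ((σ : ℂ) * (ℓ : ℂ)) * μ ^ (j + 1) by rw [hA]; ring,
    show μ ^ j * ((ℓ : ℂ) * Complex.exp ((W₁.phase s).φ * Complex.I)) = ((σ : ℂ) * (ℓ : ℂ)) * μ ^ (j - 1) by rw [hB]; ring]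

/-! ## §3 The gauged twisted chain as a.e. derivatives of the representatives; the three named shapes -/

/-- **THE GAUGED TWISTED CHAIN ODE, a.e.**: for a.e. `t ∈ (0,T)`, IF `t` lies in slot `s`, then for every `j : ℤ` the gauged representative
`x ↦ μ^j • modeRepθ … (K₀ + jK_s) x` (`μ = σ·e^{−iφ_s}`, `σ = ±1`) has derivative
`−4π² • P^θ_{Kⱼ} T_{(𝔹^{G₀})ᵀ}(Kⱼ) w̃ⱼ(t) + (σℓ(t)) • P^θ_{Kⱼ} (w̃ⱼ₊₁(t) − w̃ⱼ₋₁(t))` at `t`, where `w̃ⱼ(t) = μ^j • modeRepθ … Kⱼ t` and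
`ℓ(t) = (ê_s·K₀)(1/n)trap_s(t)/(2|m_s|)` (all modes read on their continuous representatives).
[cite: MeshalkinSinai1961, pp. 1700–1705] [cite: Temam1984, Ch. III §1.1] -/
theorem ae_hasDerivAt_gauged_chain_frame (W₁ : LatticeWord k₀) (n : ℕ) {T : ℝ} (hT : 0 ≤ T) {𝔹 : Torus.Visc4 (Fin 3)}
    {G₀ : Matrix (Fin 3) (Fin 3) ℝ}
    {F : UnitAddTorus (Fin 3) → EuclideanSpace ℝ (Fin 3)} {u : ℝ → UnitAddTorus (Fin 3) → EuclideanSpace ℝ (Fin 3)}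
    (h : Torus.IsWeakTensorPassiveVectorDistortedOn 0 T 𝔹 (W₁.cell n) (fun _ _ => G₀) F u) (hF : Integrable F volume) (s : Fin k₀) (K0 : Fin 3 → ℤ)
    {σ : ℝ} (hσ : σ = 1 ∨ σ = -1) :
    ∀ᵐ t ∂(volume.restrict (Ioo 0 T)),
      Int.fract (t / W₁.period) * W₁.period ∈ Icc (W₁.start s) (W₁.start s + (W₁.phase s).τ) →
      ∀ j : ℤ, HasDerivAt (fun x => ((σ : ℂ) * starRingEnd ℂ (Complex.exp ((W₁.phase s).φ * Complex.I))) ^ j • modeRepθ W₁ n 𝔹 G₀ F u (K0 + j • (fun i => (W₁.phase s).m i * (n : ℤ))) x)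
        (-(((4 * Real.pi ^ 2 : ℝ) : ℂ) • Torus.transversalProjR (Torus.twistFreq G₀ (K0 + j • (fun i => (W₁.phase s).m i * (n : ℤ))))
            (Torus.symbT (Torus.majorTranspose (Torus.Visc4.conj G₀ 𝔹)) (K0 + j • (fun i => (W₁.phase s).m i * (n : ℤ)))
              (((σ : ℂ) * starRingEnd ℂ (Complex.exp ((W₁.phase s).φ * Complex.I))) ^ j • modeRepθ W₁ n 𝔹 G₀ F u (K0 + j • (fun i => (W₁.phase s).m i * (n : ℤ))) t))) +
          ((σ * ((∑ a, (W₁.phase s).e a * (K0 a : ℝ)) * ((1 / (n : ℝ)) * LatticeWord.trapezoid (W₁.start s) (W₁.phase s).τ W₁.ramp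
          (Int.fract (t / W₁.period) * W₁.period)) / (2 * ‖latticeVec (W₁.phase s).m‖) : ℝ) : ℝ) : ℂ) •
            Torus.transversalProjR (Torus.twistFreq G₀ (K0 + j • (fun i => (W₁.phase s).m i * (n : ℤ))))
            (((σ : ℂ) * starRingEnd ℂ (Complex.exp ((W₁.phase s).φ * Complex.I))) ^ (j + 1) • modeRepθ W₁ n 𝔹 G₀ F u (K0 + (j + 1) • (fun i => (W₁.phase s).m i * (n : ℤ))) t -
              ((σ : ℂ) * starRingEnd ℂ (Complex.exp ((W₁.phase s).φ * Complex.I))) ^ (j - 1) • modeRepθ W₁ n 𝔹 G₀ F u (K0 + (j - 1) • (fun i => (W₁.phase s).m i * (n : ℤ))) t)) t := by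
  have hd : ∀ᵐ t ∂(volume.restrict (Ioo 0 T)), ∀ k, HasDerivAt (modeRepθ W₁ n 𝔹 G₀ F u k) (modeRHSθ W₁ n 𝔹 G₀ u k t) t :=
    ae_all_iff.2 fun k => ae_restrict_hasDerivAt_modeRepθ W₁ n hT h k
  filter_upwards [hd, ae_forall_eq_modeRepθ W₁ n hT h hF] with t hdt hrep hslot j
  have h1 := (hdt (K0 + j • (fun i => (W₁.phase s).m i * (n : ℤ)))).const_smul (((σ : ℂ) * starRingEnd ℂ (Complex.exp ((W₁.phase s).φ * Complex.I))) ^ j)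
  rw [smul_zpow_modeRHSθ_chain W₁ n 𝔹 G₀ u s K0 hσ j hslot, hrep, hrep, hrep] at h1
  exact h1

/-- `dWpR` rearranged: `dWpR l q w₀ w₊₊ y₊ = −y₊ + l • P_q (w₊₊ − w₀)`. [cite: BedrossianCotiZelati2017, §2 (hypocoercivity functional with a cross term)] -/
theorem dWpR_eq_neg_add (l : ℝ) (q : Fin 3 → ℝ) (w0 wpp yp : EuclideanSpace ℂ (Fin 3)) :
    dWpR l q w0 wpp yp = -yp + (l : ℂ) • Torus.transversalProjR q (wpp - w0) := by
  rw [dWpR, map_sub, smul_sub, smul_sub]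
  abel

/-- `dWmR` rearranged: `dWmR l q w₀ w₋₋ y₋ = −y₋ + l • P_q (w₀ − w₋₋)`. [cite: BedrossianCotiZelati2017, §2 (hypocoercivity functional with a cross term)] -/
theorem dWmR_eq_neg_add (l : ℝ) (q : Fin 3 → ℝ) (w0 wmm ym : EuclideanSpace ℂ (Fin 3)) :
    dWmR l q w0 wmm ym = -ym + (l : ℂ) • Torus.transversalProjR q (w0 - wmm) := by
  rw [dWmR, map_sub, smul_sub, smul_sub]
  abel

/-- **Mode `0` of the gauged twisted chain has the shape `dW0R`** (`…W7ThreeModeDefsR`): with `Kⱼ = K₀ + jK_s`, `w̃ⱼ = μ^j • modeRepθ … Kⱼ`,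
`ỹ₀ = 4π² • P^θ_{K₀} T_{(𝔹^{G₀})ᵀ}(K₀) w̃₀`, `l = σℓ`: `HasDerivAt w̃₀ (dW0R l (G₀ᵀK₀) w̃₁ w̃₋₁ ỹ₀) t` for a.e. `t` in slot `s`.
[cite: BedrossianCotiZelati2017, §2 (hypocoercivity functional with a cross term)] -/
theorem ae_hasDerivAt_gauged_dW0R_frame (W₁ : LatticeWord k₀) (n : ℕ) {T : ℝ} (hT : 0 ≤ T) {𝔹 : Torus.Visc4 (Fin 3)}
    {G₀ : Matrix (Fin 3) (Fin 3) ℝ}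
    {F : UnitAddTorus (Fin 3) → EuclideanSpace ℝ (Fin 3)} {u : ℝ → UnitAddTorus (Fin 3) → EuclideanSpace ℝ (Fin 3)}
    (h : Torus.IsWeakTensorPassiveVectorDistortedOn 0 T 𝔹 (W₁.cell n) (fun _ _ => G₀) F u) (hF : Integrable F volume) (s : Fin k₀) (K0 : Fin 3 → ℤ)
    {σ : ℝ} (hσ : σ = 1 ∨ σ = -1) :
    ∀ᵐ t ∂(volume.restrict (Ioo 0 T)),
      Int.fract (t / W₁.period) * W₁.period ∈ Icc (W₁.start s) (W₁.start s + (W₁.phase s).τ) →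
      HasDerivAt (fun x => ((σ : ℂ) * starRingEnd ℂ (Complex.exp ((W₁.phase s).φ * Complex.I))) ^ (0:ℤ) • modeRepθ W₁ n 𝔹 G₀ F u (K0 + (0:ℤ) • (fun i => (W₁.phase s).m i * (n : ℤ))) x)
        (dW0R (σ * ((∑ a, (W₁.phase s).e a * (K0 a : ℝ)) * ((1 / (n : ℝ)) * LatticeWord.trapezoid (W₁.start s) (W₁.phase s).τ W₁.ramp
          (Int.fract (t / W₁.period) * W₁.period)) / (2 * ‖latticeVec (W₁.phase s).m‖) : ℝ)) (Torus.twistFreq G₀ (K0 + (0:ℤ) • (fun i => (W₁.phase s).m i * (n : ℤ))))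
          (((σ : ℂ) * starRingEnd ℂ (Complex.exp ((W₁.phase s).φ * Complex.I))) ^ (1:ℤ) • modeRepθ W₁ n 𝔹 G₀ F u (K0 + (1:ℤ) • (fun i => (W₁.phase s).m i * (n : ℤ))) t)
          (((σ : ℂ) * starRingEnd ℂ (Complex.exp ((W₁.phase s).φ * Complex.I))) ^ (-1:ℤ) • modeRepθ W₁ n 𝔹 G₀ F u (K0 + (-1:ℤ) • (fun i => (W₁.phase s).m i * (n : ℤ))) t)
          (((4 * Real.pi ^ 2 : ℝ) : ℂ) • Torus.transversalProjR (Torus.twistFreq G₀ (K0 + (0:ℤ) • (fun i => (W₁.phase s).m i * (n : ℤ))))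
            (Torus.symbT (Torus.majorTranspose (Torus.Visc4.conj G₀ 𝔹)) (K0 + (0:ℤ) • (fun i => (W₁.phase s).m i * (n : ℤ)))
              (((σ : ℂ) * starRingEnd ℂ (Complex.exp ((W₁.phase s).φ * Complex.I))) ^ (0:ℤ) • modeRepθ W₁ n 𝔹 G₀ F u (K0 + (0:ℤ) • (fun i => (W₁.phase s).m i * (n : ℤ))) t)))) t := by
  filter_upwards [ae_hasDerivAt_gauged_chain_frame W₁ n hT h hF s K0 hσ] with t ht hslot
  have h0 := ht hslot 0
  rw [dW0R]
  convert h0 using 2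
  all_goals norm_num

/-- **Mode `+1` has the shape `dWpR`**: `HasDerivAt w̃₁ (dWpR l (G₀ᵀK₁) w̃₀ w̃₂ ỹ₁) t` for a.e. `t` in slot `s`.
[cite: BedrossianCotiZelati2017, §2 (hypocoercivity functional with a cross term)] -/
theorem ae_hasDerivAt_gauged_dWpR_frame (W₁ : LatticeWord k₀) (n : ℕ) {T : ℝ} (hT : 0 ≤ T) {𝔹 : Torus.Visc4 (Fin 3)}
    {G₀ : Matrix (Fin 3) (Fin 3) ℝ}
    {F : UnitAddTorus (Fin 3) → EuclideanSpace ℝ (Fin 3)} {u : ℝ → UnitAddTorus (Fin 3) → EuclideanSpace ℝ (Fin 3)}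
    (h : Torus.IsWeakTensorPassiveVectorDistortedOn 0 T 𝔹 (W₁.cell n) (fun _ _ => G₀) F u) (hF : Integrable F volume) (s : Fin k₀) (K0 : Fin 3 → ℤ)
    {σ : ℝ} (hσ : σ = 1 ∨ σ = -1) :
    ∀ᵐ t ∂(volume.restrict (Ioo 0 T)),
      Int.fract (t / W₁.period) * W₁.period ∈ Icc (W₁.start s) (W₁.start s + (W₁.phase s).τ) →
      HasDerivAt (fun x => ((σ : ℂ) * starRingEnd ℂ (Complex.exp ((W₁.phase s).φ * Complex.I))) ^ (1:ℤ) • modeRepθ W₁ n 𝔹 G₀ F u (K0 + (1:ℤ) • (fun i => (W₁.phase s).m i * (n : ℤ))) x)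
        (dWpR (σ * ((∑ a, (W₁.phase s).e a * (K0 a : ℝ)) * ((1 / (n : ℝ)) * LatticeWord.trapezoid (W₁.start s) (W₁.phase s).τ W₁.ramp
          (Int.fract (t / W₁.period) * W₁.period)) / (2 * ‖latticeVec (W₁.phase s).m‖) : ℝ)) (Torus.twistFreq G₀ (K0 + (1:ℤ) • (fun i => (W₁.phase s).m i * (n : ℤ))))
          (((σ : ℂ) * starRingEnd ℂ (Complex.exp ((W₁.phase s).φ * Complex.I))) ^ (0:ℤ) • modeRepθ W₁ n 𝔹 G₀ F u (K0 + (0:ℤ) • (fun i => (W₁.phase s).m i * (n : ℤ))) t)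
          (((σ : ℂ) * starRingEnd ℂ (Complex.exp ((W₁.phase s).φ * Complex.I))) ^ (2:ℤ) • modeRepθ W₁ n 𝔹 G₀ F u (K0 + (2:ℤ) • (fun i => (W₁.phase s).m i * (n : ℤ))) t)
          (((4 * Real.pi ^ 2 : ℝ) : ℂ) • Torus.transversalProjR (Torus.twistFreq G₀ (K0 + (1:ℤ) • (fun i => (W₁.phase s).m i * (n : ℤ))))
            (Torus.symbT (Torus.majorTranspose (Torus.Visc4.conj G₀ 𝔹)) (K0 + (1:ℤ) • (fun i => (W₁.phase s).m i * (n : ℤ)))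
              (((σ : ℂ) * starRingEnd ℂ (Complex.exp ((W₁.phase s).φ * Complex.I))) ^ (1:ℤ) • modeRepθ W₁ n 𝔹 G₀ F u (K0 + (1:ℤ) • (fun i => (W₁.phase s).m i * (n : ℤ))) t)))) t := by
  filter_upwards [ae_hasDerivAt_gauged_chain_frame W₁ n hT h hF s K0 hσ] with t ht hslot
  have h0 := ht hslot 1
  rw [dWpR_eq_neg_add]
  convert h0 using 2
  all_goals norm_num

/-- **Mode `−1` has the shape `dWmR`**: `HasDerivAt w̃₋₁ (dWmR l (G₀ᵀK₋₁) w̃₀ w̃₋₂ ỹ₋₁) t` for a.e. `t` in slot `s`.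
[cite: BedrossianCotiZelati2017, §2 (hypocoercivity functional with a cross term)] -/
theorem ae_hasDerivAt_gauged_dWmR_frame (W₁ : LatticeWord k₀) (n : ℕ) {T : ℝ} (hT : 0 ≤ T) {𝔹 : Torus.Visc4 (Fin 3)}
    {G₀ : Matrix (Fin 3) (Fin 3) ℝ}
    {F : UnitAddTorus (Fin 3) → EuclideanSpace ℝ (Fin 3)} {u : ℝ → UnitAddTorus (Fin 3) → EuclideanSpace ℝ (Fin 3)}
    (h : Torus.IsWeakTensorPassiveVectorDistortedOn 0 T 𝔹 (W₁.cell n) (fun _ _ => G₀) F u) (hF : Integrable F volume) (s : Fin k₀) (K0 : Fin 3 → ℤ)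
    {σ : ℝ} (hσ : σ = 1 ∨ σ = -1) :
    ∀ᵐ t ∂(volume.restrict (Ioo 0 T)),
      Int.fract (t / W₁.period) * W₁.period ∈ Icc (W₁.start s) (W₁.start s + (W₁.phase s).τ) →
      HasDerivAt (fun x => ((σ : ℂ) * starRingEnd ℂ (Complex.exp ((W₁.phase s).φ * Complex.I))) ^ (-1:ℤ) • modeRepθ W₁ n 𝔹 G₀ F u (K0 + (-1:ℤ) • (fun i => (W₁.phase s).m i * (n : ℤ))) x)
        (dWmR (σ * ((∑ a, (W₁.phase s).e a * (K0 a : ℝ)) * ((1 / (n : ℝ)) * LatticeWord.trapezoid (W₁.start s) (W₁.phase s).τ W₁.ramp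
          (Int.fract (t / W₁.period) * W₁.period)) / (2 * ‖latticeVec (W₁.phase s).m‖) : ℝ)) (Torus.twistFreq G₀ (K0 + (-1:ℤ) • (fun i => (W₁.phase s).m i * (n : ℤ))))
          (((σ : ℂ) * starRingEnd ℂ (Complex.exp ((W₁.phase s).φ * Complex.I))) ^ (0:ℤ) • modeRepθ W₁ n 𝔹 G₀ F u (K0 + (0:ℤ) • (fun i => (W₁.phase s).m i * (n : ℤ))) t)
          (((σ : ℂ) * starRingEnd ℂ (Complex.exp ((W₁.phase s).φ * Complex.I))) ^ (-2:ℤ) • modeRepθ W₁ n 𝔹 G₀ F u (K0 + (-2:ℤ) • (fun i => (W₁.phase s).m i * (n : ℤ))) t)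
          (((4 * Real.pi ^ 2 : ℝ) : ℂ) • Torus.transversalProjR (Torus.twistFreq G₀ (K0 + (-1:ℤ) • (fun i => (W₁.phase s).m i * (n : ℤ))))
            (Torus.symbT (Torus.majorTranspose (Torus.Visc4.conj G₀ 𝔹)) (K0 + (-1:ℤ) • (fun i => (W₁.phase s).m i * (n : ℤ)))
              (((σ : ℂ) * starRingEnd ℂ (Complex.exp ((W₁.phase s).φ * Complex.I))) ^ (-1:ℤ) • modeRepθ W₁ n 𝔹 G₀ F u (K0 + (-1:ℤ) • (fun i => (W₁.phase s).m i * (n : ℤ))) t)))) t := by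
  filter_upwards [ae_hasDerivAt_gauged_chain_frame W₁ n hT h hF s K0 hσ] with t ht hslot
  have h0 := ht hslot (-1)
  rw [dWmR_eq_neg_add]
  convert h0 using 2
  all_goals norm_num

end Summit.AnomalousDissipation.AnomalousDissipation.Theorems.SolenoidalFractalHomogenisation.LagrangianStep.CellChain

end
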